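import Literature.Probability.Percolation.IsoradialSquareLatticeGM
import Literature.Probability.Percolation.IsoradialProofs
import HarnessLib

/-!
# `G^◇_{α,β}` is a rhombic tiling: Grimmett–Manolescu's isoradial square lattices lie in `𝒢(ε, 1)`

Topic `Literature/Probability/Percolation`; sequel of
`Literature.Probability.Percolation.IsoradialSquareLatticeGM`, which constructs the isoradial
square lattice `G_{α,β}` of G. R. Grimmett, I. Manolescu, *Bond percolation on isoradial graphs:
criticality and universality*, PTRF 159 (2014) 273–327 = arXiv:1204.0505, §4.6, as a
`RhombicEmbedding (zdGraph 2) (Site 2)` (`gmEmbedding α β`: the diamond vertex `v_{i,j}` at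
`D(i,j) = H_α(i) + H_β(j)`) and proves isoradiality, the half-angles, BAP(ε) ⟺ (4.5), the
canonical measure `P_{α,β}` and SGP(1). Here the remaining printed property is proved: **the
diamond graph `G^◇_{α,β}` is a rhombic tiling of the plane** ("for two vectors `α, β` satisfying
(4.5), we may construct the diamond graph `G^◇_{α,β}` as in Figure 4.4. This gives rise to an
isoradial square lattice denoted `G_{α,β}`"), i.e. the tree's `RhombicEmbedding.IsRhombicTiling`
(`Isoradial.lean`: rhombus interiors pairwise disjoint, rhombi covering `ℂ`, face centres pairwise
distinct), under the uniform angle condition (4.5), `β_j - α_i ∈ [2ε, π - 2ε]` (`ε > 0`; half-angle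
units of the tree, see the first file). Consequently `G_{α,β}` satisfies **every hypothesis of the
box-crossing Theorem 3.1** as vendored in the tree (`gm_boxCrossing`), and Corollary 6.2 of the
paper ("every isoradial square lattice satisfying BAP(ε) has the box-crossing property") is, for
these lattices, literally an instance of that fact
(`hasBoxCrossingProperty_gmEmbedding_of_gm_boxCrossing`).

## The proof (a global argument; the paper leaves planarity to Figure 4.4)

Uniform positivity of the crossings is what matters: with `a_i = e^{iα_i}`, `b_j = e^{iβ_j}` and the
planar cross product `×` (`RandomPlanarGeometry.cross`), (4.5) gives `a_i × b_j = sin (β_j - α_i) ≥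
c := sin 2ε > 0` for all `i, j` (`sin_two_mul_le_cross`). Let `A_α`, `A_β : ℝ → ℂ` be the unit-speed
polylines through the track heights (`polyline`; `A_α(s) = H_α(⌊s⌋) + (s - ⌊s⌋) a_⌊s⌋`), and
`F(s, t) = A_α(s) + A_β(t)` (`gmPlaneMap`) — the piecewise-affine parametrisation of `G^◇_{α,β}`
mapping `[i,i+1] × [j,j+1]` onto the closed rhombus `t_i ∩ s_j` (`gmCell`, `gmPlaneMap_mem_gmCell`).

* *Monotonicity of functionals* (`le_functional_polyline_sub`): if a real-linear functional `Λ`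
  has `Λ(a_i) ≥ c` for all `i`, then `Λ(A(s)) - Λ(A(s')) ≥ c (s - s')` for `s' ≤ s`. Applied to
  `· × b_j`, `a_i × ·` and iterated, `(A_α(s) - A_α(s')) × (A_β(t) - A_β(t')) ≥ c (s-s')(t-t')`
  (`le_cross_polyline_sub_polyline_sub`); applied to `-⟨·, w⟩` for unit `w`, the polylines are
  `1`-Lipschitz (`norm_polyline_sub_le`).
* *`F` is injective* (`gmPlaneMap_injective`): `F(s,t) = F(s',t')` makes `A_α(s) - A_α(s')` equal
  to `∓(A_β(t) - A_β(t'))`, whose cross product with itself vanishes, forcing `s = s'` or `t = t'`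
  and then both.
* *`F` is surjective* (`gmPlaneMap_surjective`): in the orthonormal frame `(-i b₀, b₀)`
  (`frame_decomposition`), first solve the transverse coordinate `· × b₀ = p × b₀` on each line
  `t = const` (the map `s ↦ A_α(s) × b₀` is continuous and advances at speed `≥ c`, hence onto:
  `Continuous.surjective`), obtaining `S(t)`; along `t ↦ F(S(t), t)` the longitudinal coordinate
  `⟨·, b₀⟩` is Lipschitz and advances at speed `≥ c` (a short computation with cross products, the
  transverse coordinates cancelling), hence is onto as well.
* *Cells are the rhombi* (`rhombus_gmEmbedding`): the corner set of the rhombus of every dart is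
  `{D, D + b_j, D + a_i + b_j, D + a_i}` with `(i, j) = (columnIndex e, trackIndex e)`
  (`corners_eq_gmCorners`, four cases), and a parallelogram is the convex hull of its corners
  (`convexHull_parallelogram`); `e ↦ (columnIndex e, trackIndex e)` is a bijection from the edges of
  `ℤ²` onto `ℤ²` (`edge_eq_of_indices_eq`, `exists_edge_of_indices`); interior points of a cell have
  affine coordinates in `(0,1)²` (`exists_eq_gmPlaneMap_of_mem_interior_gmCell`).
* Covering = surjectivity of `F`; disjointness of interiors = injectivity of `F` on the open squares
  plus injectivity of the indices; distinct face centres = `gmFace_injective` (first file).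

## References

* G. R. Grimmett, I. Manolescu, PTRF 159 (2014) 273–327, arXiv:1204.0505: §4.6 (G_{α,β}, (4.5),
  Figure 4.4), §6.1 (Cor. 6.2), §3 (Thm 3.1), §2.1 (isoradial graphs and rhombic tilings).
* R. Kenyon, J.-M. Schlenker, *Rhombic embeddings of planar quad-graphs*, TAMS 357 (2005), §1, §3
  (quad-graphs from two families of parallel curves).
-/

noncomputable section

open Complex
open scoped Real

namespace Literature.Probability.Percolation

open LatticeModels LatticeModels.RhombicEmbedding
open Literature.Probability.RandomPlanarGeometry (cross)


/-! ### Linear functionals of the plane -/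

/-- `z ↦ z × v` as a real-linear functional. [folklore] -/
def crossLeft (v : ℂ) : ℂ →ₗ[ℝ] ℝ where
  toFun z := cross z v
  map_add' z z' := cross_add_left z z' v
  map_smul' r z := by simp only [cross, Complex.real_smul, Complex.mul_re, Complex.mul_im,
    Complex.ofReal_re, Complex.ofReal_im, RingHom.id_apply, smul_eq_mul]; ring

/-- `z ↦ v × z` as a real-linear functional. [folklore] -/
def crossRight (v : ℂ) : ℂ →ₗ[ℝ] ℝ where
  toFun z := cross v z
  map_add' z z' := cross_add_right v z z'
  map_smul' r z := by simp only [cross, Complex.real_smul, Complex.mul_re, Complex.mul_im,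
    Complex.ofReal_re, Complex.ofReal_im, RingHom.id_apply, smul_eq_mul]; ring

/-- The Euclidean inner product `z ↦ ⟨z, v⟩ = re z re v + im z im v` as a real-linear functional.
[folklore] -/
def dotWith (v : ℂ) : ℂ →ₗ[ℝ] ℝ where
  toFun z := z.re * v.re + z.im * v.im
  map_add' z z' := by simp only [Complex.add_re, Complex.add_im]; ring
  map_smul' r z := by simp only [Complex.real_smul, Complex.mul_re, Complex.mul_im,
    Complex.ofReal_re, Complex.ofReal_im, RingHom.id_apply, smul_eq_mul]; ring

/-- Unfolding `crossLeft`. [folklore] -/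
@[simp] theorem crossLeft_apply (v z : ℂ) : crossLeft v z = cross z v := rfl

/-- Unfolding `crossRight`. [folklore] -/
@[simp] theorem crossRight_apply (v z : ℂ) : crossRight v z = cross v z := rfl

/-- Unfolding `dotWith`. [folklore] -/
@[simp] theorem dotWith_apply (v z : ℂ) : dotWith v z = z.re * v.re + z.im * v.im := rfl

/-- Norm in the frame of a unit vector: `‖z‖² = (z × b)² + ⟨z, b⟩²`. [folklore] -/
theorem sq_norm_eq_frame {b : ℂ} (hb : ‖b‖ = 1) (z : ℂ) :
    ‖z‖ ^ 2 = (cross z b) ^ 2 + (dotWith b z) ^ 2 := by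
  have h1 : b.re * b.re + b.im * b.im = 1 := by
    have := Complex.sq_norm b
    rw [hb, one_pow, Complex.normSq_apply] at this
    linarith
  rw [Complex.sq_norm, Complex.normSq_apply, cross, dotWith_apply]
  linear_combination (-(z.re * z.re + z.im * z.im)) * h1

/-- Cauchy–Schwarz for the inner product with a unit vector: `⟨z, v⟩ ≤ ‖z‖` if `‖v‖ = 1`. [folklore] -/
theorem dotWith_le_norm {v : ℂ} (hv : ‖v‖ = 1) (z : ℂ) : dotWith v z ≤ ‖z‖ := by
  have h := sq_norm_eq_frame hv z
  have : (dotWith v z) ^ 2 ≤ ‖z‖ ^ 2 := by nlinarith [sq_nonneg (cross z v)]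
  exact (abs_le_of_sq_le_sq' this (norm_nonneg z)).2

/-- `|z × v| ≤ ‖z‖` for a unit vector `v`. [folklore] -/
theorem abs_cross_le_norm {v : ℂ} (hv : ‖v‖ = 1) (z : ℂ) : |cross z v| ≤ ‖z‖ := by
  have h := sq_norm_eq_frame hv z
  have : (cross z v) ^ 2 ≤ ‖z‖ ^ 2 := by nlinarith [sq_nonneg (dotWith v z)]
  exact abs_le.2 (abs_le_of_sq_le_sq' this (norm_nonneg z))

/-- **Frame decomposition**: for a unit vector `b`, every `z` equals `(z × b)(-ib) + ⟨z, b⟩ b`.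
[folklore] -/
theorem frame_decomposition {b : ℂ} (hb : ‖b‖ = 1) (z : ℂ) :
    z = (cross z b : ℂ) * (-I * b) + (dotWith b z : ℂ) * b := by
  have h1 : b.re * b.re + b.im * b.im = 1 := by
    have := Complex.sq_norm b
    rw [hb, one_pow, Complex.normSq_apply] at this
    linarith
  apply Complex.ext
  · simp only [cross, dotWith_apply, Complex.add_re, Complex.mul_re, Complex.mul_im, Complex.ofReal_re,
      Complex.ofReal_im, Complex.neg_re, Complex.neg_im, Complex.I_re, Complex.I_im]
    linear_combination (-z.re) * h1
  · simp only [cross, dotWith_apply, Complex.add_im, Complex.mul_re, Complex.mul_im, Complex.ofReal_re,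
      Complex.ofReal_im, Complex.neg_re, Complex.neg_im, Complex.I_re, Complex.I_im]
    linear_combination (-z.im) * h1

/-- A real-linear functional pulls out real scalars written as complex products. [folklore] -/
theorem map_ofReal_mul (Λ : ℂ →ₗ[ℝ] ℝ) (r : ℝ) (z : ℂ) : Λ ((r : ℂ) * z) = r * Λ z := by
  rw [← Complex.real_smul, map_smul, smul_eq_mul]

/-! ### Polylines: piecewise-linear interpolation of track heights -/

/-- The polyline through the track heights: `A_θ(s) = H_θ(⌊s⌋) + (s - ⌊s⌋) e^{iθ_⌊s⌋}`, the arc-length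
parametrisation of the boundary of the row/column of rhombi between two consecutive parallel
tracks. [cite: GrimmettManolescu2014Isoradial, §4.6 (Figure 4.4)] -/
def polyline (θ : ℤ → ℝ) (s : ℝ) : ℂ :=
  trackHeight θ ⌊s⌋ + ((s - ⌊s⌋ : ℝ) : ℂ) * cexp ((θ ⌊s⌋ : ℂ) * I)

/-- On the closed piece `[n, n+1]` the polyline is affine: `A(s) = H(n) + (s - n) e^{iθ_n}` (at the
right endpoint by `H(n+1) = H(n) + e^{iθ_n}`). [folklore] -/
theorem polyline_of_mem_Icc (θ : ℤ → ℝ) {n : ℤ} {s : ℝ} (hs : s ∈ Set.Icc (n : ℝ) (n + 1)) :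
    polyline θ s = trackHeight θ n + ((s - n : ℝ) : ℂ) * cexp ((θ n : ℂ) * I) := by
  rcases hs.2.eq_or_lt with h | h
  · have hfl : ⌊s⌋ = n + 1 := by rw [h]; exact_mod_cast Int.floor_intCast (n + 1)
    rw [polyline, hfl, h, trackHeight_add_one]
    push_cast
    ring
  · have hfl : ⌊s⌋ = n := Int.floor_eq_iff.2 ⟨hs.1, h⟩
    rw [polyline, hfl]

/-- At integers the polyline passes through the track heights. [folklore] -/
theorem polyline_intCast (θ : ℤ → ℝ) (n : ℤ) : polyline θ n = trackHeight θ n := by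
  rw [polyline_of_mem_Icc θ (n := n) ⟨le_rfl, by linarith⟩]
  simp

/-- **Monotonicity of linear functionals along a polyline**: if `Λ(e^{iθ_i}) ≥ c` for every `i`,
then `Λ(A(s)) - Λ(A(s')) ≥ c (s - s')` for `s' ≤ s` (the pieces of `A` have slope `≥ c` under `Λ`).
[folklore] -/
theorem le_functional_polyline_sub (θ : ℤ → ℝ) (Λ : ℂ →ₗ[ℝ] ℝ) {c : ℝ}
    (hΛ : ∀ i, c ≤ Λ (cexp ((θ i : ℂ) * I))) {s' s : ℝ} (hss : s' ≤ s) :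
    c * (s - s') ≤ Λ (polyline θ s) - Λ (polyline θ s') := by
  -- `g u := Λ (A u) - c u` is monotone
  set g : ℝ → ℝ := fun u => Λ (polyline θ u) - c * u with hg
  -- within a closed piece
  have piece : ∀ (n : ℤ) (u v : ℝ), (n : ℝ) ≤ u → u ≤ v → v ≤ n + 1 → g u ≤ g v := by
    intro n u v hu huv hv
    simp only [hg, polyline_of_mem_Icc θ (n := n) ⟨hu, huv.trans hv⟩,
      polyline_of_mem_Icc θ (n := n) ⟨hu.trans huv, hv⟩, map_add, map_ofReal_mul]
    have := hΛ n
    nlinarith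
  -- along integers
  have ints : ∀ (n : ℤ) (k : ℕ), g n ≤ g (n + k) := by
    intro n k
    induction k with
    | zero => simp
    | succ k ih =>
      refine ih.trans ?_
      have := piece (n + k) (n + k) (n + (k + 1 : ℕ)) (by push_cast; linarith) (by push_cast; linarith)
        (by push_cast; linarith)
      exact_mod_cast this
  suffices g s' ≤ g s by simp only [hg] at this; linarith
  rcases lt_or_ge (⌊s'⌋) (⌊s⌋) with hlt | hge
  · obtain ⟨k, hk⟩ := Int.le.dest (Int.add_one_le_of_lt hlt)
    have hk' : (((⌊s'⌋ + 1 : ℤ) : ℝ) + k) = (⌊s⌋ : ℝ) := by exact_mod_cast hk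
    calc g s' ≤ g ((⌊s'⌋ + 1 : ℤ) : ℝ) :=
          piece ⌊s'⌋ s' _ (Int.floor_le s') (by push_cast; exact (Int.lt_floor_add_one s').le)
            (by push_cast; linarith)
      _ ≤ g (((⌊s'⌋ + 1 : ℤ) : ℝ) + k) := ints (⌊s'⌋ + 1) k
      _ = g (⌊s⌋ : ℝ) := by rw [hk']
      _ ≤ g s := piece ⌊s⌋ _ s le_rfl (Int.floor_le s) (Int.lt_floor_add_one s).le
  · have heq : ⌊s'⌋ = ⌊s⌋ := le_antisymm (Int.floor_le_floor hss) hge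
    exact piece ⌊s⌋ s' s (heq ▸ Int.floor_le s') hss (Int.lt_floor_add_one s).le

/-- **The polyline is `1`-Lipschitz** (unit-speed pieces): `‖A(s) - A(s')‖ ≤ |s - s'|`. [folklore] -/
theorem norm_polyline_sub_le (θ : ℤ → ℝ) (s s' : ℝ) : ‖polyline θ s - polyline θ s'‖ ≤ |s - s'| := by
  -- for every unit vector `w`, `⟨A s - A s', w⟩ ≤ |s - s'|`, by the functional lemma for `-⟨·, w⟩`
  wlog hss : s' ≤ s generalizing s s'
  · rw [← norm_neg, neg_sub, abs_sub_comm]; exact this s' s (le_of_not_ge hss)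
  rw [abs_of_nonneg (sub_nonneg.2 hss)]
  set z := polyline θ s - polyline θ s' with hz
  by_cases hz0 : z = 0
  · rw [hz0, norm_zero]; linarith
  set w : ℂ := ((‖z‖⁻¹ : ℝ) : ℂ) * z with hw
  have hzn : 0 < ‖z‖ := norm_pos_iff.2 hz0
  have hw1 : ‖w‖ = 1 := by
    rw [hw, norm_mul, Complex.norm_real, Real.norm_of_nonneg (inv_nonneg.2 hzn.le), inv_mul_cancel₀ hzn.ne']
  have key := le_functional_polyline_sub θ (-dotWith w) (c := -1)
    (fun i => by
      rw [LinearMap.neg_apply, neg_le_neg_iff]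
      exact (dotWith_le_norm hw1 _).trans_eq (Complex.norm_exp_ofReal_mul_I _)) hss
  simp only [LinearMap.neg_apply] at key
  -- `key : -1 * (s - s') ≤ -(dot w (A s)) - -(dot w (A s'))`, i.e. `dot w z ≤ s - s'`
  have hdz : dotWith w z = ‖z‖ := by
    rw [dotWith_apply, hw]
    simp only [Complex.mul_re, Complex.mul_im, Complex.ofReal_re, Complex.ofReal_im, zero_mul, sub_zero, add_zero]
    have h2 : z.re * z.re + z.im * z.im = ‖z‖ ^ 2 := by rw [Complex.sq_norm, Complex.normSq_apply]
    field_simp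
    nlinarith [h2]
  have : dotWith w z = dotWith w (polyline θ s) - dotWith w (polyline θ s') := by
    rw [hz, map_sub]
  linarith

/-- `u × (r w) = r (u × w)` for real `r`. [folklore] -/
theorem cross_ofReal_mul_right (u w : ℂ) (r : ℝ) : cross u ((r : ℂ) * w) = r * cross u w := by
  simp only [cross, Complex.mul_re, Complex.mul_im, Complex.ofReal_re, Complex.ofReal_im]; ring

/-- `|⟨z, v⟩| ≤ ‖z‖` for a unit vector `v`. [folklore] -/
theorem abs_dotWith_le_norm {v : ℂ} (hv : ‖v‖ = 1) (z : ℂ) : |dotWith v z| ≤ ‖z‖ := by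
  rw [abs_le]
  refine ⟨?_, dotWith_le_norm hv z⟩
  have := dotWith_le_norm hv (-z)
  rw [map_neg, norm_neg] at this
  linarith

/-! ### The map `(s, t) ↦ A_α(s) + B_β(t)` is a bijection of the plane -/

section PlaneMap

variable {α β : ℤ → ℝ} {c : ℝ}

/-- The piecewise-affine parametrisation of the diamond graph `G^◇_{α,β}`:
`F(s, t) = A_α(s) + A_β(t)`, sending the unit square `[i, i+1] × [j, j+1]` affinely onto the
rhombus `t_i ∩ s_j` and the lattice point `(i, j)` to `v_{i,j}`. [cite: GrimmettManolescu2014Isoradial, §4.6 (Figure 4.4)] -/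
def gmPlaneMap (α β : ℤ → ℝ) (p : ℝ × ℝ) : ℂ := polyline α p.1 + polyline β p.2

/-- At lattice points the plane map is the diamond vertex. [folklore] -/
theorem gmPlaneMap_intCast (α β : ℤ → ℝ) (i j : ℤ) :
    gmPlaneMap α β ((i : ℝ), (j : ℝ)) = gmDiamond α β i j := by
  rw [gmPlaneMap, polyline_intCast, polyline_intCast, gmDiamond]

/-- `c (t - t') ≤ e^{iα_i} × (B(t) - B(t'))` for `t' ≤ t`. [folklore] -/
theorem le_cross_exp_polyline_sub (h : ∀ i j, c ≤ cross (cexp ((α i : ℂ) * I)) (cexp ((β j : ℂ) * I)))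
    (i : ℤ) {t' t : ℝ} (htt : t' ≤ t) :
    c * (t - t') ≤ cross (cexp ((α i : ℂ) * I)) (polyline β t - polyline β t') := by
  have := le_functional_polyline_sub β (crossRight (cexp ((α i : ℂ) * I))) (fun j => h i j) htt
  rwa [← map_sub, crossRight_apply] at this

/-- `c (s - s') ≤ (A(s) - A(s')) × e^{iβ_j}` for `s' ≤ s`. [folklore] -/
theorem le_cross_polyline_sub_exp (h : ∀ i j, c ≤ cross (cexp ((α i : ℂ) * I)) (cexp ((β j : ℂ) * I)))
    (j : ℤ) {s' s : ℝ} (hss : s' ≤ s) :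
    c * (s - s') ≤ cross (polyline α s - polyline α s') (cexp ((β j : ℂ) * I)) := by
  have := le_functional_polyline_sub α (crossLeft (cexp ((β j : ℂ) * I))) (fun i => h i j) hss
  rwa [← map_sub, crossLeft_apply] at this

/-- **The bilinear estimate**: `c (s - s')(t - t') ≤ (A(s) - A(s')) × (B(t) - B(t'))` for `s' ≤ s`,
`t' ≤ t`. [folklore] -/
theorem le_cross_polyline_sub_polyline_sub
    (h : ∀ i j, c ≤ cross (cexp ((α i : ℂ) * I)) (cexp ((β j : ℂ) * I)))
    {s' s t' t : ℝ} (hss : s' ≤ s) (htt : t' ≤ t) :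
    c * (s - s') * (t - t') ≤ cross (polyline α s - polyline α s') (polyline β t - polyline β t') := by
  have := le_functional_polyline_sub α (crossLeft (polyline β t - polyline β t')) (c := c * (t - t'))
    (fun i => by rw [crossLeft_apply]; exact le_cross_exp_polyline_sub h i htt) hss
  rw [← map_sub, crossLeft_apply] at this
  have e : c * (s - s') * (t - t') = c * (t - t') * (s - s') := by ring
  linarith

/-- **`F` is injective** when all crossings are uniformly positive, `e^{iα_i} × e^{iβ_j} ≥ c > 0`.
[cite: GrimmettManolescu2014Isoradial, §4.6 (G^◇_{α,β} is a rhombic tiling)] -/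
theorem gmPlaneMap_injective (hc : 0 < c)
    (h : ∀ i j, c ≤ cross (cexp ((α i : ℂ) * I)) (cexp ((β j : ℂ) * I))) :
    Function.Injective (gmPlaneMap α β) := by
  -- from `B t = B t'` deduce `t = t'`, and from `A s = A s'` deduce `s = s'`
  have hB : ∀ t t' : ℝ, polyline β t = polyline β t' → t = t' := by
    intro t t' heq
    rcases le_total t' t with htt | htt
    · have := le_cross_exp_polyline_sub h 0 htt
      rw [heq, sub_self] at this
      simp only [cross, Complex.zero_re, Complex.zero_im, mul_zero, sub_zero] at this
      nlinarith
    · have := le_cross_exp_polyline_sub h 0 htt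
      rw [heq, sub_self] at this
      simp only [cross, Complex.zero_re, Complex.zero_im, mul_zero, sub_zero] at this
      nlinarith
  have hA : ∀ s s' : ℝ, polyline α s = polyline α s' → s = s' := by
    intro s s' heq
    rcases le_total s' s with hss | hss
    · have := le_cross_polyline_sub_exp h 0 hss
      rw [heq, sub_self] at this
      simp only [cross, Complex.zero_re, Complex.zero_im, zero_mul, sub_zero] at this
      nlinarith
    · have := le_cross_polyline_sub_exp h 0 hss
      rw [heq, sub_self] at this
      simp only [cross, Complex.zero_re, Complex.zero_im, zero_mul, sub_zero] at this
      nlinarith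
  -- main argument, first for `s' ≤ s`
  have key : ∀ (s t s' t' : ℝ), s' ≤ s → gmPlaneMap α β (s, t) = gmPlaneMap α β (s', t') →
      (s, t) = (s', t') := by
    intro s t s' t' hss heq
    simp only [gmPlaneMap] at heq
    have hAB : polyline α s - polyline α s' = -(polyline β t - polyline β t') := by
      linear_combination heq
    rcases le_total t' t with htt | htt
    · have h3 := le_cross_polyline_sub_polyline_sub h hss htt
      rw [hAB, cross_neg_left, cross_self, neg_zero] at h3
      have hprod : (s - s') * (t - t') = 0 := by
        apply le_antisymm _ (mul_nonneg (sub_nonneg.2 hss) (sub_nonneg.2 htt))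
        nlinarith
      rcases mul_eq_zero.1 hprod with h0 | h0
      · have hs : s = s' := by linarith
        subst hs
        have : polyline β t = polyline β t' := by linear_combination heq
        rw [hB t t' this]
      · have ht : t = t' := by linarith
        subst ht
        have : polyline α s = polyline α s' := by linear_combination heq
        rw [hA s s' this]
    · have h3 := le_cross_polyline_sub_polyline_sub h hss htt
      have hAB' : polyline α s - polyline α s' = polyline β t' - polyline β t := by
        linear_combination heq
      rw [hAB', cross_self] at h3
      have hs : s = s' := by
        rcases htt.eq_or_lt with htt' | htt'
        · subst htt'
          have : polyline α s = polyline α s' := by linear_combination heq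
          exact hA s s' this
        · by_contra hne
          have hlt : s' < s := lt_of_le_of_ne hss (Ne.symm hne)
          nlinarith [mul_pos (mul_pos hc (sub_pos.2 hlt)) (sub_pos.2 htt')]
      subst hs
      have : polyline β t = polyline β t' := by linear_combination heq
      rw [hB t t' this]
  rintro ⟨s, t⟩ ⟨s', t'⟩ heq
  rcases le_total s' s with hss | hss
  · exact key s t s' t' hss heq
  · exact (key s' t' s t hss heq.symm).symm

/-- The polyline is continuous. [folklore] -/
theorem continuous_polyline (θ : ℤ → ℝ) : Continuous (polyline θ) :=
  (LipschitzWith.of_dist_le_mul (K := 1) fun x y => by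
    rw [dist_eq_norm, Real.dist_eq, NNReal.coe_one, one_mul]
    exact norm_polyline_sub_le θ x y).continuous

/-- **`F` is surjective** when all crossings are uniformly positive: in the frame of `b_0` one first
solves the transverse coordinate `· × b_0 = p × b_0` on each column-line `t = const` (the polyline
`A_α` advances at speed `≥ c` in that coordinate), then the longitudinal coordinate along the
resulting curve, which advances at speed `≥ c` as well.
[cite: GrimmettManolescu2014Isoradial, §4.6 (G^◇_{α,β} is a rhombic tiling)] -/
theorem gmPlaneMap_surjective (hc : 0 < c)
    (h : ∀ i j, c ≤ cross (cexp ((α i : ℂ) * I)) (cexp ((β j : ℂ) * I))) :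
    Function.Surjective (gmPlaneMap α β) := by
  intro p
  set b₀ : ℂ := cexp ((β 0 : ℂ) * I) with hb₀
  set a₀ : ℂ := cexp ((α 0 : ℂ) * I) with ha₀
  have hb1 : ‖b₀‖ = 1 := Complex.norm_exp_ofReal_mul_I _
  have ha1 : ‖a₀‖ = 1 := Complex.norm_exp_ofReal_mul_I _
  set ℓ : ℂ →ₗ[ℝ] ℝ := crossLeft b₀ with hℓ
  set m : ℂ →ₗ[ℝ] ℝ := dotWith b₀ with hm
  have hc1 : c ≤ 1 := (h 0 0).trans ((le_abs_self _).trans ((abs_cross_le_norm hb1 a₀).trans_eq ha1))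
  -- transverse speed of `A`
  have hℓA : ∀ {s' s : ℝ}, s' ≤ s → c * (s - s') ≤ ℓ (polyline α s) - ℓ (polyline α s') := by
    intro s' s hss
    have := le_cross_polyline_sub_exp h 0 hss
    rwa [← map_sub, hℓ, crossLeft_apply]
  -- Step 1: solve the transverse coordinate on each line `t = const`
  have step1 : ∀ t : ℝ, ∃ s : ℝ, ℓ (polyline α s) + ℓ (polyline β t) = ℓ p := by
    intro t
    have hcont : Continuous fun s => ℓ (polyline α s) + ℓ (polyline β t) :=
      ((LinearMap.continuous_of_finiteDimensional ℓ).comp (continuous_polyline α)).add continuous_const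
    have htop : Filter.Tendsto (fun s => ℓ (polyline α s) + ℓ (polyline β t)) Filter.atTop Filter.atTop := by
      refine Filter.tendsto_atTop_mono' Filter.atTop
        (Filter.eventually_atTop.2 ⟨0, fun s hs => ?_⟩)
        (Filter.tendsto_atTop_add_const_left _ (ℓ (polyline α 0) + ℓ (polyline β t))
          (Filter.tendsto_id.const_mul_atTop hc))
      have := hℓA hs; simp only [id]; linarith
    have hbot : Filter.Tendsto (fun s => ℓ (polyline α s) + ℓ (polyline β t)) Filter.atBot Filter.atBot := by
      refine Filter.tendsto_atBot_mono' Filter.atBot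
        (Filter.eventually_atBot.2 ⟨0, fun s hs => ?_⟩)
        (Filter.tendsto_atBot_add_const_left _ (ℓ (polyline α 0) + ℓ (polyline β t))
          (Filter.tendsto_id.const_mul_atBot hc))
      have := hℓA hs; simp only [id]; linarith
    exact hcont.surjective htop hbot (ℓ p)
  choose S hS using step1
  -- Step 2: the longitudinal coordinate along `t ↦ F(S t, t)`
  set φ : ℝ → ℝ := fun t => m (polyline α (S t) + polyline β t) with hφ
  -- the increment `y = φ t - φ t'` and the frame identity `u + v = y b₀`
  have frame : ∀ t t' : ℝ,
      (polyline α (S t) - polyline α (S t')) + (polyline β t - polyline β t') =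
        ((φ t - φ t' : ℝ) : ℂ) * b₀ := by
    intro t t'
    set w := (polyline α (S t) - polyline α (S t')) + (polyline β t - polyline β t') with hw
    have hℓw : cross w b₀ = 0 := by
      have e1 := hS t
      have e2 := hS t'
      have : ℓ w = 0 := by
        rw [hw, map_add, map_sub, map_sub]; linarith
      simpa [hℓ] using this
    have hmw : dotWith b₀ w = φ t - φ t' := by
      simp only [hφ, hm, hw, map_add, map_sub]; ring
    have := frame_decomposition hb1 w
    rw [hℓw, hmw] at this
    simpa using this
  -- Step 2a: `φ` advances at speed `≥ c`
  have key2 : ∀ {t' t : ℝ}, t' ≤ t → c * (t - t') ≤ φ t - φ t' := by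
    intro t' t htt
    set y := φ t - φ t' with hy
    set u := polyline α (S t) - polyline α (S t') with hu
    set v := polyline β t - polyline β t' with hv
    have huv : u + v = (y : ℂ) * b₀ := frame t t'
    have hv2 : c * (t - t') ≤ cross a₀ v := le_cross_exp_polyline_sub h 0 htt
    have hab : c ≤ cross a₀ b₀ := h 0 0
    have hab1 : cross a₀ b₀ ≤ 1 := (le_abs_self _).trans ((abs_cross_le_norm hb1 a₀).trans_eq ha1)
    rcases lt_trichotomy (S t') (S t) with hs | hs | hs
    · -- `S t' < S t`
      have h3 : c * (S t - S t') * (t - t') ≤ cross u v := le_cross_polyline_sub_polyline_sub h hs.le htt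
      have hℓu : c * (S t - S t') ≤ cross u b₀ := by
        have := hℓA hs.le; rwa [← map_sub, hℓ, crossLeft_apply] at this
      have hℓu' : cross u b₀ ≤ S t - S t' :=
        (le_abs_self _).trans ((abs_cross_le_norm hb1 u).trans
          ((norm_polyline_sub_le α _ _).trans_eq (abs_of_pos (sub_pos.2 hs))))
      have hcuv : cross u v = y * cross u b₀ := by
        rw [show v = (y : ℂ) * b₀ - u by rw [← huv]; ring, ← neg_add_eq_sub, cross_add_right,
          cross_neg_right, cross_self, neg_zero, zero_add, cross_ofReal_mul_right]
      rw [hcuv] at h3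
      have hpos : 0 < cross u b₀ := by nlinarith
      have hy0 : 0 ≤ y := by
        by_contra hy0
        push Not at hy0
        nlinarith [mul_nonneg (sub_nonneg.2 hs.le) (sub_nonneg.2 htt)]
      nlinarith
    · -- `S t' = S t`: `u = 0`, `v = y b₀`
      have hu0 : u = 0 := by rw [hu, hs, sub_self]
      rw [hu0, zero_add] at huv
      rw [huv, cross_ofReal_mul_right] at hv2
      have hy0 : 0 ≤ y := by
        by_contra hy0
        push Not at hy0
        nlinarith [sub_nonneg.2 htt]
      nlinarith
    · -- `S t < S t'`: work with `u' = -u`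
      have h3 : c * (S t' - S t) * (t - t') ≤ cross (-u) v := by
        have := le_cross_polyline_sub_polyline_sub h hs.le htt
        rwa [show polyline α (S t') - polyline α (S t) = -u by rw [hu]; ring] at this
      have hℓu : c * (S t' - S t) ≤ cross (-u) b₀ := by
        have := hℓA hs.le
        rwa [← map_sub, hℓ, crossLeft_apply, show polyline α (S t') - polyline α (S t) = -u by
          rw [hu]; ring] at this
      have hℓu' : cross (-u) b₀ ≤ S t' - S t :=
        (le_abs_self _).trans ((abs_cross_le_norm hb1 (-u)).trans
          ((norm_neg u).trans_le ((norm_polyline_sub_le α _ _).trans_eq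
            (by rw [abs_sub_comm]; exact abs_of_pos (sub_pos.2 hs)))))
      have hcuv : cross (-u) v = y * cross (-u) b₀ := by
        rw [show v = (y : ℂ) * b₀ + (-u) by rw [← huv]; ring, cross_add_right, cross_self, add_zero,
          cross_ofReal_mul_right]
      rw [hcuv] at h3
      have hpos : 0 < cross (-u) b₀ := by nlinarith
      have hy0 : 0 ≤ y := by
        by_contra hy0
        push Not at hy0
        nlinarith [mul_nonneg (sub_nonneg.2 hs.le) (sub_nonneg.2 htt)]
      nlinarith
  -- Step 2b: `φ` is Lipschitz
  have key3 : ∀ t t' : ℝ, |φ t - φ t'| ≤ (1 + c⁻¹) * |t - t'| := by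
    intro t t'
    set y := φ t - φ t' with hy
    set u := polyline α (S t) - polyline α (S t') with hu
    set v := polyline β t - polyline β t' with hv
    have huv : u + v = (y : ℂ) * b₀ := frame t t'
    have hvn : ‖v‖ ≤ |t - t'| := norm_polyline_sub_le β t t'
    have hℓuv : cross u b₀ = -cross v b₀ := by
      have : cross (u + v) b₀ = 0 := by
        rw [huv, cross, Complex.mul_re, Complex.mul_im, Complex.ofReal_re, Complex.ofReal_im]; ring
      rw [cross_add_left] at this; linarith
    have hun : ‖u‖ ≤ c⁻¹ * |t - t'| := by
      have h1 : ‖u‖ ≤ |S t - S t'| := norm_polyline_sub_le α _ _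
      have h2 : c * |S t - S t'| ≤ |cross u b₀| := by
        rcases le_total (S t') (S t) with hs | hs
        · rw [abs_of_nonneg (sub_nonneg.2 hs)]
          have := hℓA hs
          rw [← map_sub, hℓ, crossLeft_apply] at this
          exact this.trans (le_abs_self _)
        · rw [abs_sub_comm, abs_of_nonneg (sub_nonneg.2 hs)]
          have := hℓA hs
          rw [← map_sub, hℓ, crossLeft_apply, show polyline α (S t') - polyline α (S t) = -u by
            rw [hu]; ring, cross_neg_left] at this
          exact this.trans (neg_le_abs _)
      have h3 : |cross u b₀| ≤ |t - t'| := by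
        rw [hℓuv, abs_neg]; exact (abs_cross_le_norm hb1 v).trans hvn
      rw [le_inv_mul_iff₀ hc]
      calc c * ‖u‖ ≤ c * |S t - S t'| := mul_le_mul_of_nonneg_left h1 hc.le
        _ ≤ |t - t'| := h2.trans h3
    have hyn : |y| ≤ ‖u + v‖ := by
      have := abs_dotWith_le_norm hb1 (u + v)
      rwa [huv, dotWith_apply, Complex.mul_re, Complex.mul_im, Complex.ofReal_re, Complex.ofReal_im,
        show (y * b₀.re - 0 * b₀.im) * b₀.re + (y * b₀.im + 0 * b₀.re) * b₀.im = y * (b₀.re * b₀.re + b₀.im * b₀.im)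
          by ring, show b₀.re * b₀.re + b₀.im * b₀.im = 1 by
            have := Complex.sq_norm b₀; rw [hb1, one_pow, Complex.normSq_apply] at this; linarith,
        mul_one, ← huv] at this
    calc |y| ≤ ‖u + v‖ := hyn
      _ ≤ ‖u‖ + ‖v‖ := norm_add_le u v
      _ ≤ c⁻¹ * |t - t'| + |t - t'| := add_le_add hun hvn
      _ = (1 + c⁻¹) * |t - t'| := by ring
  -- Step 3: `φ` is surjective
  have hφcont : Continuous φ := by
    refine (LipschitzWith.of_dist_le_mul (K := (1 + c⁻¹).toNNReal) fun x y => ?_).continuous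
    rw [Real.dist_eq, Real.dist_eq, Real.coe_toNNReal _ (by positivity)]
    exact key3 x y
  have hφtop : Filter.Tendsto φ Filter.atTop Filter.atTop := by
    refine Filter.tendsto_atTop_mono' Filter.atTop (Filter.eventually_atTop.2 ⟨0, fun t ht => ?_⟩)
      (Filter.tendsto_atTop_add_const_left _ (φ 0) (Filter.tendsto_id.const_mul_atTop hc))
    have := key2 ht; simp only [id]; linarith
  have hφbot : Filter.Tendsto φ Filter.atBot Filter.atBot := by
    refine Filter.tendsto_atBot_mono' Filter.atBot (Filter.eventually_atBot.2 ⟨0, fun t ht => ?_⟩)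
      (Filter.tendsto_atBot_add_const_left _ (φ 0) (Filter.tendsto_id.const_mul_atBot hc))
    have := key2 ht; simp only [id]; linarith
  obtain ⟨t, ht⟩ := hφcont.surjective hφtop hφbot (m p)
  refine ⟨(S t, t), ?_⟩
  -- both frame coordinates agree
  set z := polyline α (S t) + polyline β t with hz
  have hℓz : cross z b₀ = cross p b₀ := by
    have := hS t
    rw [← map_add, hℓ, crossLeft_apply] at this
    exact this
  have hmz : dotWith b₀ z = dotWith b₀ p := ht
  change z = p
  rw [frame_decomposition hb1 z, frame_decomposition hb1 p, hℓz, hmz]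

end PlaneMap

/-! ### The rhombi of `G_{α,β}` are the cells of the plane map -/

section Cells

variable {α β : ℤ → ℝ}

/-- The closed **cell** of the rhombus `t_i ∩ s_j`: the parallelogram
`{D(i,j) + σ e^{iα_i} + τ e^{iβ_j} : σ, τ ∈ [0, 1]}`. [cite: GrimmettManolescu2014Isoradial, §4.6 (the rhombus t_i ∩ s_j)] -/
def gmCell (α β : ℤ → ℝ) (i j : ℤ) : Set ℂ :=
  {z | ∃ σ ∈ Set.Icc (0 : ℝ) 1, ∃ τ ∈ Set.Icc (0 : ℝ) 1,
    z = gmDiamond α β i j + (σ : ℂ) * cexp ((α i : ℂ) * I) + (τ : ℂ) * cexp ((β j : ℂ) * I)}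

/-- The plane map sends `[i, i+1] × [j, j+1]` into the cell `(i, j)`. [folklore] -/
theorem gmPlaneMap_mem_gmCell {i j : ℤ} {s t : ℝ} (hs : s ∈ Set.Icc (i : ℝ) (i + 1))
    (ht : t ∈ Set.Icc (j : ℝ) (j + 1)) : gmPlaneMap α β (s, t) ∈ gmCell α β i j := by
  refine ⟨s - i, ⟨by linarith [hs.1], by linarith [hs.2]⟩, t - j, ⟨by linarith [ht.1], by linarith [ht.2]⟩, ?_⟩
  rw [gmPlaneMap, polyline_of_mem_Icc α hs, polyline_of_mem_Icc β ht, gmDiamond]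
  ring

/-- Conversely every point of the cell `(i, j)` is a value of the plane map on
`[i, i+1] × [j, j+1]`. [folklore] -/
theorem exists_eq_gmPlaneMap_of_mem_gmCell {i j : ℤ} {z : ℂ} (hz : z ∈ gmCell α β i j) :
    ∃ σ ∈ Set.Icc (0 : ℝ) 1, ∃ τ ∈ Set.Icc (0 : ℝ) 1, z = gmPlaneMap α β ((i : ℝ) + σ, (j : ℝ) + τ) := by
  obtain ⟨σ, hσ, τ, hτ, rfl⟩ := hz
  refine ⟨σ, hσ, τ, hτ, ?_⟩
  rw [gmPlaneMap, polyline_of_mem_Icc α (n := i) ⟨by linarith [hσ.1], by linarith [hσ.2]⟩,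
    polyline_of_mem_Icc β (n := j) ⟨by linarith [hτ.1], by linarith [hτ.2]⟩, gmDiamond]
  push_cast
  ring

/-- **A parallelogram is the convex hull of its corners**:
`conv {D, D + b, D + a + b, D + a} = {D + σ a + τ b : σ, τ ∈ [0, 1]}`. [folklore] -/
theorem convexHull_parallelogram (D a b : ℂ) :
    convexHull ℝ ({D, D + b, D + a + b, D + a} : Set ℂ) =
      {z | ∃ σ ∈ Set.Icc (0 : ℝ) 1, ∃ τ ∈ Set.Icc (0 : ℝ) 1, z = D + (σ : ℂ) * a + (τ : ℂ) * b} := by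
  apply Set.Subset.antisymm
  · refine convexHull_min ?_ ?_
    · intro w hw
      simp only [Set.mem_insert_iff, Set.mem_singleton_iff] at hw
      rcases hw with rfl | rfl | rfl | rfl
      · exact ⟨0, ⟨le_rfl, zero_le_one⟩, 0, ⟨le_rfl, zero_le_one⟩, by push_cast; ring⟩
      · exact ⟨0, ⟨le_rfl, zero_le_one⟩, 1, ⟨zero_le_one, le_rfl⟩, by push_cast; ring⟩
      · exact ⟨1, ⟨zero_le_one, le_rfl⟩, 1, ⟨zero_le_one, le_rfl⟩, by push_cast; ring⟩
      · exact ⟨1, ⟨zero_le_one, le_rfl⟩, 0, ⟨le_rfl, zero_le_one⟩, by push_cast; ring⟩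
    · intro z hz w hw p q hp hq hpq
      obtain ⟨σ, hσ, τ, hτ, rfl⟩ := hz
      obtain ⟨σ', hσ', τ', hτ', rfl⟩ := hw
      refine ⟨p * σ + q * σ', ⟨by nlinarith [hσ.1, hσ'.1], by nlinarith [hσ.2, hσ'.2]⟩,
        p * τ + q * τ', ⟨by nlinarith [hτ.1, hτ'.1], by nlinarith [hτ.2, hτ'.2]⟩, ?_⟩
      simp only [Complex.real_smul]
      have hpq' : (p : ℂ) + q = 1 := by exact_mod_cast hpq
      push_cast
      linear_combination D * hpq'
  · rintro z ⟨σ, hσ, τ, hτ, rfl⟩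
    have hD : D ∈ ({D, D + b, D + a + b, D + a} : Set ℂ) := by simp
    have hDb : D + b ∈ ({D, D + b, D + a + b, D + a} : Set ℂ) := by simp
    have hDab : D + a + b ∈ ({D, D + b, D + a + b, D + a} : Set ℂ) := by simp
    have hDa : D + a ∈ ({D, D + b, D + a + b, D + a} : Set ℂ) := by simp
    have h1 : D + (τ : ℂ) * b ∈ convexHull ℝ ({D, D + b, D + a + b, D + a} : Set ℂ) := by
      refine segment_subset_convexHull hD hDb ⟨1 - τ, τ, by linarith [hτ.2], hτ.1, by ring, ?_⟩
      simp only [Complex.real_smul]; push_cast; ring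
    have h2 : D + a + (τ : ℂ) * b ∈ convexHull ℝ ({D, D + b, D + a + b, D + a} : Set ℂ) := by
      refine segment_subset_convexHull hDa hDab ⟨1 - τ, τ, by linarith [hτ.2], hτ.1, by ring, ?_⟩
      simp only [Complex.real_smul]; push_cast; ring
    refine (convex_convexHull ℝ _).segment_subset h1 h2 ⟨1 - σ, σ, by linarith [hσ.2], hσ.1, by ring, ?_⟩
    simp only [Complex.real_smul]; push_cast; ring

/-- The corners of the cell `(i, j)`: `D`, `D + e^{iβ_j}`, `D + e^{iα_i} + e^{iβ_j}`, `D + e^{iα_i}`. [folklore] -/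
def gmCorners (α β : ℤ → ℝ) (i j : ℤ) : Set ℂ :=
  {gmDiamond α β i j, gmDiamond α β i j + cexp ((β j : ℂ) * I),
    gmDiamond α β i j + cexp ((α i : ℂ) * I) + cexp ((β j : ℂ) * I), gmDiamond α β i j + cexp ((α i : ℂ) * I)}

/-- The cell is the convex hull of its corners. [folklore] -/
theorem convexHull_gmCorners (α β : ℤ → ℝ) (i j : ℤ) : convexHull ℝ (gmCorners α β i j) = gmCell α β i j :=
  convexHull_parallelogram _ _ _

/-- **The corner set of the rhombus of every dart is that of the cell `(columnIndex, trackIndex)`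
of its edge.** [cite: GrimmettManolescu2014Isoradial, §4.6 (v_{i,j} adjacent to t_{i-1}, t_i, s_{j-1}, s_j)] -/
theorem corners_eq_gmCorners (d : (zdGraph 2).Dart) :
    ({(gmEmbedding α β).z d.fst, (gmEmbedding α β).c ((gmEmbedding α β).leftFace d),
        (gmEmbedding α β).z d.snd, (gmEmbedding α β).c ((gmEmbedding α β).rightFace d)} : Set ℂ) =
      gmCorners α β (columnIndex d.edge) (trackIndex d.edge) := by
  simp only [gmEmbedding_z, gmEmbedding_c, gmEmbedding_leftFace, gmEmbedding_rightFace]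
  rcases zdGraph_two_dart_cases d with h | h | h | h
  · -- east: tail `x = v_{i,j}`, cell `(i, j)`
    have hedge : d.edge = s(d.fst, d.fst + Pi.single 0 1) := by rw [← h]; rfl
    rw [hedge, columnIndex_horizontal, trackIndex_horizontal, h, squareLeftFace_east, squareLeftFace_west,
      gmFace_sub_single_one, gmFace_self, gmVertex_add_single_zero, gmCorners, gmVertex]
    ext w
    simp only [Set.mem_insert_iff, Set.mem_singleton_iff]
    constructor <;> rintro (rfl | rfl | rfl | rfl) <;>
      first | (left; ring1) | (right; left; ring1) | (right; right; left; ring1) | (right; right; right; ring1)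
  · -- north: tail `x = v_{i,j}`, cell `(i - 1, j)`
    have hedge : d.edge = s(d.fst, d.fst + Pi.single 1 1) := by rw [← h]; rfl
    have hD : gmVertex α β d.fst = gmDiamond α β (d.fst 0 - d.fst 1 - 1) (d.fst 0 + d.fst 1) +
        cexp ((α (d.fst 0 - d.fst 1 - 1) : ℂ) * I) := by
      have := gmDiamond_add_one_left α β (d.fst 0 - d.fst 1 - 1) (d.fst 0 + d.fst 1)
      rw [sub_add_cancel] at this
      rw [gmVertex, this]
    rw [hedge, columnIndex_vertical, trackIndex_vertical, h, squareLeftFace_north, squareLeftFace_south,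
      gmFace_sub_single_zero, gmFace_self, gmVertex_add_single_one, gmCorners, hD]
    ext w
    simp only [Set.mem_insert_iff, Set.mem_singleton_iff]
    constructor <;> rintro (rfl | rfl | rfl | rfl) <;>
      first | (left; ring1) | (right; left; ring1) | (right; right; left; ring1) | (right; right; right; ring1)
  · -- west: tail `y + e₀`, head `y = v_{i',j'}`, cell `(i', j')`
    have hedge : d.edge = s(d.snd, d.snd + Pi.single 0 1) := by rw [Sym2.eq_swap, ← h]; rfl
    rw [hedge, columnIndex_horizontal, trackIndex_horizontal, h, squareLeftFace_east, squareLeftFace_west,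
      gmFace_sub_single_one, gmFace_self, gmVertex_add_single_zero, gmCorners, gmVertex]
    ext w
    simp only [Set.mem_insert_iff, Set.mem_singleton_iff]
    constructor <;> rintro (rfl | rfl | rfl | rfl) <;>
      first | (left; ring1) | (right; left; ring1) | (right; right; left; ring1) | (right; right; right; ring1)
  · -- south: tail `y + e₁`, head `y`, cell `(i' - 1, j')`
    have hedge : d.edge = s(d.snd, d.snd + Pi.single 1 1) := by rw [Sym2.eq_swap, ← h]; rfl
    have hD : gmVertex α β d.snd = gmDiamond α β (d.snd 0 - d.snd 1 - 1) (d.snd 0 + d.snd 1) +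
        cexp ((α (d.snd 0 - d.snd 1 - 1) : ℂ) * I) := by
      have := gmDiamond_add_one_left α β (d.snd 0 - d.snd 1 - 1) (d.snd 0 + d.snd 1)
      rw [sub_add_cancel] at this
      rw [gmVertex, this]
    rw [hedge, columnIndex_vertical, trackIndex_vertical, h, squareLeftFace_north, squareLeftFace_south,
      gmFace_sub_single_zero, gmFace_self, gmVertex_add_single_one, gmCorners, hD]
    ext w
    simp only [Set.mem_insert_iff, Set.mem_singleton_iff]
    constructor <;> rintro (rfl | rfl | rfl | rfl) <;>
      first | (left; ring1) | (right; left; ring1) | (right; right; left; ring1) | (right; right; right; ring1)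

/-- **The rhombi of `G_{α,β}` are the cells**: `rhombus e = gmCell (columnIndex e) (trackIndex e)`.
[cite: GrimmettManolescu2014Isoradial, §4.6] -/
theorem rhombus_gmEmbedding (h : ∀ i j, 0 < β j - α i ∧ β j - α i < π) (e : (zdGraph 2).edgeSet) :
    (gmEmbedding α β).rhombus e = gmCell α β (columnIndex e) (trackIndex e) := by
  have hde : (refDart e).edge = (e : Sym2 (Site 2)) := refDart_edge e
  rw [(gmEmbedding α β).rhombus_eq_of_dart_edge (isIsoradial_gmEmbedding h) hde, corners_eq_gmCorners,
    hde, convexHull_gmCorners]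

/-- Every edge of `ℤ²` is a horizontal edge `{x, x + e₀}` or a vertical edge `{x, x + e₁}`. [folklore] -/
theorem edge_cases (e : (zdGraph 2).edgeSet) :
    ∃ x : Site 2, (e : Sym2 (Site 2)) = s(x, x + Pi.single 0 1) ∨ (e : Sym2 (Site 2)) = s(x, x + Pi.single 1 1) := by
  have hde : (refDart e).edge = (e : Sym2 (Site 2)) := refDart_edge e
  rcases zdGraph_two_dart_cases (refDart e) with h | h | h | h
  · exact ⟨(refDart e).fst, Or.inl (by rw [← hde, ← h]; rfl)⟩
  · exact ⟨(refDart e).fst, Or.inr (by rw [← hde, ← h]; rfl)⟩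
  · exact ⟨(refDart e).snd, Or.inl (by rw [← hde, Sym2.eq_swap, ← h]; rfl)⟩
  · exact ⟨(refDart e).snd, Or.inr (by rw [← hde, Sym2.eq_swap, ← h]; rfl)⟩

/-- **An edge is determined by its cell**: `e ↦ (columnIndex e, trackIndex e)` is injective on
the edges of `ℤ²`. [folklore] -/
theorem edge_eq_of_indices_eq {e e' : (zdGraph 2).edgeSet} (hc : columnIndex e = columnIndex e')
    (ht : trackIndex e = trackIndex e') : e = e' := by
  obtain ⟨x, hx | hx⟩ := edge_cases e <;> obtain ⟨y, hy | hy⟩ := edge_cases e' <;>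
    rw [hx, hy] at hc ht <;>
    simp only [columnIndex_horizontal, columnIndex_vertical, trackIndex_horizontal, trackIndex_vertical] at hc ht
  · have : x = y := site_eq_of_diff_eq_of_sum_eq hc ht
    subst this; exact Subtype.ext (hx.trans hy.symm)
  · omega
  · omega
  · have : x = y := site_eq_of_diff_eq_of_sum_eq (by omega) ht
    subst this; exact Subtype.ext (hx.trans hy.symm)

/-- **Every cell is the rhombus of an edge**: for `(i, j) ∈ ℤ²` there is an edge of `ℤ²` in the
track `t_i` and the track `s_j` (horizontal if `i + j` is even, vertical otherwise). [folklore] -/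
theorem exists_edge_of_indices (i j : ℤ) :
    ∃ e : (zdGraph 2).edgeSet, columnIndex e = i ∧ trackIndex e = j := by
  rcases Int.even_or_odd (i + j) with ⟨k, hk⟩ | ⟨k, hk⟩
  · let x : Site 2 := ![k, k - i]
    have hadj : (zdGraph 2).Adj x (x + Pi.single 0 1) := (zdGraph_adj_iff _ _).2 ⟨0, Or.inl rfl⟩
    refine ⟨⟨s(x, x + Pi.single 0 1), hadj⟩, ?_, ?_⟩
    · change columnIndex s(x, x + Pi.single 0 1) = i
      rw [columnIndex_horizontal]; change k - (k - i) = i; omega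
    · change trackIndex s(x, x + Pi.single 0 1) = j
      rw [trackIndex_horizontal]; change k + (k - i) = j; omega
  · let x : Site 2 := ![k + 1, k - i]
    have hadj : (zdGraph 2).Adj x (x + Pi.single 1 1) := (zdGraph_adj_iff _ _).2 ⟨1, Or.inl rfl⟩
    refine ⟨⟨s(x, x + Pi.single 1 1), hadj⟩, ?_, ?_⟩
    · change columnIndex s(x, x + Pi.single 1 1) = i
      rw [columnIndex_vertical]; change k + 1 - (k - i) - 1 = i; omega
    · change trackIndex s(x, x + Pi.single 1 1) = j
      rw [trackIndex_vertical]; change k + 1 + (k - i) = j; omega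

/-- **Interior points of a cell have coordinates in `(0, 1)`** (when the cell is non-degenerate,
`e^{iα_i} × e^{iβ_j} ≠ 0`): they are values of the plane map on the open square. [folklore] -/
theorem exists_eq_gmPlaneMap_of_mem_interior_gmCell {i j : ℤ}
    (hab : 0 < cross (cexp ((α i : ℂ) * I)) (cexp ((β j : ℂ) * I))) {z : ℂ}
    (hz : z ∈ interior (gmCell α β i j)) :
    ∃ σ ∈ Set.Ioo (0 : ℝ) 1, ∃ τ ∈ Set.Ioo (0 : ℝ) 1, z = gmPlaneMap α β ((i : ℝ) + σ, (j : ℝ) + τ) := by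
  set a := cexp ((α i : ℂ) * I) with ha
  set b := cexp ((β j : ℂ) * I) with hb
  set D := gmDiamond α β i j with hD
  -- affine coordinates of a point of the cell
  have coords : ∀ w ∈ gmCell α β i j, cross (w - D) b / cross a b ∈ Set.Icc (0 : ℝ) 1 ∧
      cross a (w - D) / cross a b ∈ Set.Icc (0 : ℝ) 1 ∧
      w = D + ((cross (w - D) b / cross a b : ℝ) : ℂ) * a + ((cross a (w - D) / cross a b : ℝ) : ℂ) * b := by
    rintro w ⟨σ, hσ, τ, hτ, rfl⟩
    have e1 : cross (D + (σ : ℂ) * a + (τ : ℂ) * b - D) b = σ * cross a b := by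
      rw [show D + (σ : ℂ) * a + (τ : ℂ) * b - D = (σ : ℂ) * a + (τ : ℂ) * b by ring, cross_add_left]
      simp only [cross, Complex.mul_re, Complex.mul_im, Complex.ofReal_re, Complex.ofReal_im]; ring
    have e2 : cross a (D + (σ : ℂ) * a + (τ : ℂ) * b - D) = τ * cross a b := by
      rw [show D + (σ : ℂ) * a + (τ : ℂ) * b - D = (σ : ℂ) * a + (τ : ℂ) * b by ring, cross_add_right]
      simp only [cross, Complex.mul_re, Complex.mul_im, Complex.ofReal_re, Complex.ofReal_im]; ring
    rw [e1, e2, mul_div_cancel_right₀ _ hab.ne', mul_div_cancel_right₀ _ hab.ne']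
    exact ⟨hσ, hτ, rfl⟩
  obtain ⟨r, hr, hball⟩ := Metric.mem_nhds_iff.1 (mem_interior_iff_mem_nhds.1 hz)
  have hzc : z ∈ gmCell α β i j := interior_subset hz
  obtain ⟨hσz, hτz, hzrep⟩ := coords z hzc
  set σ := cross (z - D) b / cross a b with hσ
  set τ := cross a (z - D) / cross a b with hτ
  have ha1 : ‖a‖ = 1 := Complex.norm_exp_ofReal_mul_I _
  have hb1 : ‖b‖ = 1 := Complex.norm_exp_ofReal_mul_I _
  -- test points `z ± (r/2) a`, `z ± (r/2) b`
  have hmem : ∀ v : ℂ, ‖v‖ = 1 → ∀ ρ : ℝ, |ρ| < r → z + (ρ : ℂ) * v ∈ gmCell α β i j := by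
    intro v hv ρ hρ
    apply hball
    rw [Metric.mem_ball, dist_eq_norm, add_sub_cancel_left, norm_mul, Complex.norm_real, hv, mul_one,
      Real.norm_eq_abs]
    exact hρ
  have hr2 : |r / 2| < r := by rw [abs_of_pos (by positivity)]; linarith
  have hr2' : |-(r / 2)| < r := by rw [abs_neg]; exact hr2
  have k1 := (coords _ (hmem a ha1 (r / 2) hr2)).1
  have k2 := (coords _ (hmem a ha1 (-(r / 2)) hr2')).1
  have k3 := (coords _ (hmem b hb1 (r / 2) hr2)).2.1
  have k4 := (coords _ (hmem b hb1 (-(r / 2)) hr2')).2.1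
  have eσ : ∀ ρ : ℝ, cross (z + (ρ : ℂ) * a - D) b / cross a b = σ + ρ := by
    intro ρ
    rw [show z + (ρ : ℂ) * a - D = (z - D) + (ρ : ℂ) * a by ring, cross_add_left, add_div, hσ]
    congr 1
    rw [show cross ((ρ : ℂ) * a) b = ρ * cross a b by
      simp only [cross, Complex.mul_re, Complex.mul_im, Complex.ofReal_re, Complex.ofReal_im]; ring,
      mul_div_cancel_right₀ _ hab.ne']
  have eσ' : ∀ ρ : ℝ, cross (z + (ρ : ℂ) * b - D) b / cross a b = σ := by
    intro ρ
    rw [show z + (ρ : ℂ) * b - D = (z - D) + (ρ : ℂ) * b by ring, cross_add_left,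
      show cross ((ρ : ℂ) * b) b = 0 by
        simp only [cross, Complex.mul_re, Complex.mul_im, Complex.ofReal_re, Complex.ofReal_im]; ring,
      add_zero]
  have eτ : ∀ ρ : ℝ, cross a (z + (ρ : ℂ) * b - D) / cross a b = τ + ρ := by
    intro ρ
    rw [show z + (ρ : ℂ) * b - D = (z - D) + (ρ : ℂ) * b by ring, cross_add_right, add_div, hτ]
    congr 1
    rw [cross_ofReal_mul_right, mul_div_cancel_right₀ _ hab.ne']
  rw [eσ] at k1 k2
  rw [eτ] at k3 k4
  refine ⟨σ, ⟨by linarith [k2.1], by linarith [k1.2]⟩, τ, ⟨by linarith [k4.1], by linarith [k3.2]⟩, ?_⟩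
  rw [gmPlaneMap, polyline_of_mem_Icc α (n := i) ⟨by linarith [hσz.1], by linarith [hσz.2]⟩,
    polyline_of_mem_Icc β (n := j) ⟨by linarith [hτz.1], by linarith [hτz.2]⟩]
  rw [hzrep, hD, gmDiamond]
  push_cast
  ring

end Cells

/-! ### `G^◇_{α,β}` is a rhombic tiling -/

section Tiling

variable {α β : ℤ → ℝ}

/-- Under the uniform form of (4.5), all crossings are uniformly positive:
`e^{iα_i} × e^{iβ_j} = sin (β_j - α_i) ≥ sin (2ε) > 0`. [folklore] -/
theorem sin_two_mul_le_cross {ε : ℝ} (hε : 0 < ε) (h : ∀ i j, 2 * ε ≤ β j - α i ∧ β j - α i ≤ π - 2 * ε)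
    (i j : ℤ) : Real.sin (2 * ε) ≤ cross (cexp ((α i : ℂ) * I)) (cexp ((β j : ℂ) * I)) := by
  rw [cross_exp_exp]
  have h4 : 4 * ε ≤ π := by linarith [(h 0 0).1, (h 0 0).2]
  obtain ⟨h1, h2⟩ := h i j
  rcases le_or_gt (β j - α i) (π / 2) with hle | hgt
  · exact Real.sin_le_sin_of_le_of_le_pi_div_two (by linarith [Real.pi_pos]) hle h1
  · rw [← Real.sin_pi_sub (β j - α i)]
    exact Real.sin_le_sin_of_le_of_le_pi_div_two (by linarith [Real.pi_pos]) (by linarith) (by linarith)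

/-- **The diamond graph `G^◇_{α,β}` is a rhombic tiling of the plane** (Grimmett–Manolescu 2014,
§4.6: "for two vectors `α, β` satisfying (4.5), we may construct the diamond graph `G^◇_{α,β}` as in
Figure 4.4"): under the uniform angle condition `β_j - α_i ∈ [2ε, π - 2ε]`, `ε > 0`, the rhombi of
`G_{α,β}` have pairwise disjoint interiors and cover the plane, and the face centres are pairwise
distinct — the tree's `IsRhombicTiling`. Proof: the rhombi are the cells of the piecewise-affine
map `F(s,t) = A_α(s) + A_β(t)`, which is a bijection of the plane (`gmPlaneMap_injective`,
`gmPlaneMap_surjective`), interior points of a cell being values of `F` on the open unit square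
(`exists_eq_gmPlaneMap_of_mem_interior_gmCell`).
[cite: GrimmettManolescu2014Isoradial, §4.6 ("we may construct the diamond graph G^◇_{α,β} … an isoradial square lattice G_{α,β}")] -/
theorem isRhombicTiling_gmEmbedding {ε : ℝ} (hε : 0 < ε)
    (h : ∀ i j, 2 * ε ≤ β j - α i ∧ β j - α i ≤ π - 2 * ε) :
    (gmEmbedding α β).IsRhombicTiling := by
  have h4 : 4 * ε ≤ π := by linarith [(h 0 0).1, (h 0 0).2]
  have h' : ∀ i j, 0 < β j - α i ∧ β j - α i < π := fun i j =>
    ⟨by linarith [(h i j).1], by linarith [(h i j).2]⟩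
  set c := Real.sin (2 * ε) with hcdef
  have hc : 0 < c := Real.sin_pos_of_pos_of_lt_pi (by linarith) (by linarith)
  have hcross : ∀ i j, c ≤ cross (cexp ((α i : ℂ) * I)) (cexp ((β j : ℂ) * I)) :=
    sin_two_mul_le_cross hε h
  refine ⟨?_, ?_, gmFace_injective fun i j => Real.sin_pos_of_pos_of_lt_pi (h' i j).1 (h' i j).2⟩
  · -- disjoint interiors
    intro e e' hne
    refine Set.disjoint_left.2 fun z hz hz' => ?_
    rw [rhombus_gmEmbedding h'] at hz hz'
    obtain ⟨σ, hσ, τ, hτ, hzF⟩ := exists_eq_gmPlaneMap_of_mem_interior_gmCell (hc.trans_le (hcross _ _)) hz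
    obtain ⟨σ', hσ', τ', hτ', hzF'⟩ := exists_eq_gmPlaneMap_of_mem_interior_gmCell (hc.trans_le (hcross _ _)) hz'
    have hinj := gmPlaneMap_injective hc hcross (hzF.symm.trans hzF')
    simp only [Prod.mk.injEq] at hinj
    have hi : columnIndex (e : Sym2 (Site 2)) = columnIndex (e' : Sym2 (Site 2)) := by
      have h1 : ⌊(columnIndex (e : Sym2 (Site 2)) : ℝ) + σ⌋ = columnIndex (e : Sym2 (Site 2)) :=
        Int.floor_eq_iff.2 ⟨by linarith [hσ.1], by linarith [hσ.2]⟩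
      have h2 : ⌊(columnIndex (e' : Sym2 (Site 2)) : ℝ) + σ'⌋ = columnIndex (e' : Sym2 (Site 2)) :=
        Int.floor_eq_iff.2 ⟨by linarith [hσ'.1], by linarith [hσ'.2]⟩
      rw [← h1, ← h2, hinj.1]
    have hj : trackIndex (e : Sym2 (Site 2)) = trackIndex (e' : Sym2 (Site 2)) := by
      have h1 : ⌊(trackIndex (e : Sym2 (Site 2)) : ℝ) + τ⌋ = trackIndex (e : Sym2 (Site 2)) :=
        Int.floor_eq_iff.2 ⟨by linarith [hτ.1], by linarith [hτ.2]⟩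
      have h2 : ⌊(trackIndex (e' : Sym2 (Site 2)) : ℝ) + τ'⌋ = trackIndex (e' : Sym2 (Site 2)) :=
        Int.floor_eq_iff.2 ⟨by linarith [hτ'.1], by linarith [hτ'.2]⟩
      rw [← h1, ← h2, hinj.2]
    exact hne (edge_eq_of_indices_eq hi hj)
  · -- covering
    refine Set.eq_univ_of_forall fun p => ?_
    obtain ⟨⟨s, t⟩, hst⟩ := gmPlaneMap_surjective hc hcross p
    obtain ⟨e, he1, he2⟩ := exists_edge_of_indices ⌊s⌋ ⌊t⌋
    refine Set.mem_iUnion.2 ⟨e, ?_⟩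
    rw [rhombus_gmEmbedding h', he1, he2, ← hst]
    exact gmPlaneMap_mem_gmCell ⟨Int.floor_le s, (Int.lt_floor_add_one s).le⟩
      ⟨Int.floor_le t, (Int.lt_floor_add_one t).le⟩

/-- **`G_{α,β} ∈ 𝒢(ε, 1)`: all hypotheses of the box-crossing theorem** (`gm_boxCrossing`, GM14
Thm 3.1) hold for `G_{α,β}` under (4.5): it is a preconnected, isoradially embedded rhombic
tiling with BAP(ε) and the printed square-grid property. Hence Corollary 6.2 of the paper — "every
isoradial square lattice satisfying BAP(ε) has the box-crossing property" — is, for the lattices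
`G_{α,β}`, literally an instance of the tree's fact `gm_boxCrossing`.
[cite: GrimmettManolescu2014Isoradial, §6.1 Corollary 6.2 with §4.6 (4.5)] -/
theorem hasBoxCrossingProperty_gmEmbedding_of_gm_boxCrossing {ε : ℝ} (hε : 0 < ε)
    (h : ∀ i j, 2 * ε ≤ β j - α i ∧ β j - α i ≤ π - 2 * ε)
    (hbxp : gm_boxCrossing (zdGraph 2) (gmEmbedding α β) ε) :
    HasBoxCrossingProperty (gmEmbedding α β).isoradialPercolation (gmEmbedding α β).z :=
  have h' : ∀ i j, 0 < β j - α i ∧ β j - α i < π := fun i j =>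
    ⟨by linarith [(h i j).1], by linarith [(h i j).2]⟩
  hbxp gmEmbedding_preconnected (isIsoradial_gmEmbedding h') (isRhombicTiling_gmEmbedding hε h) hε
    (hasBoundedAngles_gmEmbedding hε h) (hasSquareGridPropertyGM_gmEmbedding α β)

end Tiling

end Literature.Probability.Percolation
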